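/-
Copyright (c) 2026. All rights reserved.
Released under Apache 2.0 license as described in the file LICENSE.
-/
import Literature.AlgebraicGeometry.Pohlmann1968.MultiquadraticCMFieldRankTwoCensus
import Literature.NumberTheory.ComplexMultiplication.DegenerateCMTypesElementaryAbelianOrderThirtyTwoStabilizers
import Literature.NumberTheory.ComplexMultiplication.DegenerateCMTypesAbelianStabilizerIndexBound
import Literature.NumberTheory.ComplexMultiplication.CMTypeHalfSystemDictionary
import HarnessLib

/-!
# The stabiliser incidence `Σ_T (|Stab T| − 1) = (|G| − 2)·2^{|G|/4}` for the CM types of an elementary abelian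
# `2`-group, the order-`16` census `256 = 16 + 112 + 128`, and the order-`32` census of the IMPRIMITIVE types:
# `3840` CM types of Kubota rank `9`, `4992 = 32 + 1120 + 3840` imprimitive and `60544` primitive types

SETTING (tree `CMTypeRankCharacters`, T. Kubota [Kubota1965] §4 Lemma 2 = B. B. Gordon [Gordon1999HodgeAVSurvey]
Prop. 9.4.1).  `G` a finite commutative group of exponent `2` — the Galois group of a multiquadratic CM field —
`ρ ∈ G`, `ρ ≠ 1` (complex conjugation), `T ⊆ G` a CM type (`IsCMTypeWith ρ T`: `T ⊔ ρT = G`),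
`rank(T) = 1 + #{χ odd : Σ_{t∈T} χ(t) ≠ 0}`, and `Stab(T) = {g : Tg = T}` the stabiliser (written, as in the tree's
`DegenerateCMTypesAbelianStabilizerIndexBound`, as the finset `{g : ∀ t, tg ∈ T ↔ t ∈ T}`; on the CM field: the
Galois group of the smallest subfield from which the type is induced, [Kubota1965] §2; in the Boolean dictionary of
the order-`32` file — types on `⟨ρ⟩ × 𝔽₂ⁿ` are the Boolean functions of `n` variables — the non-trivial elements of
`Stab(T)` are the `0`-linear structures of the function, C. Carlet [Carlet2020] §6.2 Def. 62).  The tree knows the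
number of all CM types (`2^{|G|/2}`, M. Kida [Kida2019CountingCMTypes] Lemma 2.3, tree `CMTypeHalfSystemDictionary`),
the number stabilised by a given `g ∉ {1, ρ}` (`2^{|G|/4}`, ibid.), the rank-`2` census (`|G|` sign sets, tree
`MultiquadraticCMFieldRankTwoCensus`), the rank-`5` census (`2·C(|G|/2, 3)`, tree
`DegenerateCMTypesElementaryAbelianRankFiveCensus`), and in order `32` the rank spectrum `{2, 5, 9, 11, 17}` with its
stabilisers (`…OrderThirtyTwo`, `…OrderThirtyTwoStabilizers`: rank `≤ 9` ⟺ imprimitive).  THIS FILE counts the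
rank-`9` types of order `32` by DOUBLE COUNTING THE INCIDENCE `{(T, g) : g ≠ 1, Tg = T}`:

> **Theorem** (`sum_card_filter_ne_one_stabilizer_eq`, every order).  On a finite commutative group of exponent `2`,
> w.r.t. any `ρ ≠ 1`: `Σ_{T CM type} (|Stab(T)| − 1) = (|G| − 2)·2^{|G|/4}` — each `g ∉ {1, ρ}` stabilises
> `2^{|G|/4}` types, `ρ` none.
> **Theorem** (`card_stabilizer_eq_of_card_eq_thirtyTwo`, order `32`).  `|Stab(T)| = 16, 4, 2, 1, 1` according as
> `rank(T) = 2, 5, 9, 11, 17`.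
> **Theorem** (`card_filter_typeRank_eq_nine_of_card_eq_thirtyTwo`).  Hence `15·32 + 3·1120 + 1·n₉ = 30·256`:
> **on the elementary abelian group of order `32` exactly `3840` of the `65536` CM types have Kubota rank `9`**;
> `4992` are imprimitive (rank `≤ 9`) and **`60544` are primitive** (rank `11` or `17`;
> `card_filter_forall_stabilizer_eq_one_of_card_eq_thirtyTwo`).
> **Theorem** (`card_filter_typeRank_eq_nine_of_card_eq_sixteen`, order `16`, group level).  `128` of the `256` CM
> types have rank `9` (the field-level form is the tree's `ncard_cmTypeRank_eq_of_finrank_eq_sixteen`).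

On the field side (§5; multiquadratic CM fields `K` of degree `32`, dictionary `CyclicPrimeSquare.ncard_cmType_sep_eq`,
`cmTypeRank_eq_typeRank_galType`): `K` has exactly `3840` CM types of rank `9` (each induced from a nondegenerate type
of one subfield of degree `16`, tree `exists_inducedCMType_sixteen_of_cmTypeRank_eq_nine_of_finrank_eq_thirtytwo`),
`4992` CM types of rank `≤ 9` and `60544` of rank `11` or `17` — by the tree's
`isSimple_iff_cmTypeRank_eq_eleven_or_seventeen` the latter are exactly the types of the SIMPLE abelian `16`-folds with
complex multiplication by `K`.

* §0 helpers.
* §1 (every order) `card_filter_ne_one_forall_mul_mem_iff` (`#{T : Tg = T} = 2^{|G|/4}` for `g ∉ {1, ρ}`, `0` for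
  `g = ρ`), **`sum_card_filter_ne_one_stabilizer_eq`**, `sum_card_stabilizer_eq`.
* §2 stabiliser orders: `two_mul_card_stabilizer_of_typeRank_eq_two` (every order: rank `2` ⟹ `|Stab| = |G|/2`),
  `card_stabilizer_eq_two_of_typeRank_eq_nine` / `card_stabilizer_eq_one_of_nine_lt_typeRank` (order `32`),
  **`card_stabilizer_eq_of_card_eq_thirtyTwo`**.
* §3 order `16`: **`card_filter_typeRank_eq_nine_of_card_eq_sixteen`** (`128`), `census_of_card_eq_sixteen`.
* §4 order `32`: **`card_filter_typeRank_eq_nine_of_card_eq_thirtyTwo`** (`3840`),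
  `card_filter_typeRank_le_nine_of_card_eq_thirtyTwo` (`4992`), `card_filter_exists_stabilizer_of_card_eq_thirtyTwo`
  (`4992` imprimitive), **`card_filter_nine_lt_typeRank_of_card_eq_thirtyTwo`** /
  `card_filter_forall_stabilizer_eq_one_of_card_eq_thirtyTwo` (`60544` primitive).
* §5 multiquadratic CM fields of degree `32`: **`ncard_cmTypeRank_eq_nine_of_finrank_eq_thirtyTwo`** (`3840`),
  `ncard_cmTypeRank_le_nine_of_finrank_eq_thirtyTwo` (`4992`), **`ncard_nine_lt_cmTypeRank_of_finrank_eq_thirtyTwo`**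
  (`60544`).

HONEST SCOPE.  Elementary double counting on results of the tree; the sources print Kubota's rank formula (Kubota,
Gordon), the induced-type / stabiliser dictionary (Kubota §2, Shimura §8.2 Prop. 26), the count `2^{½(G:H)}` of the
types induced from a quotient (Kida Lemma 2.3), Dodson's weight method for fields of type `(2, …, 2)` and the linear
structures of Boolean functions (Carlet); the NUMBERS `3840 / 4992 / 60544` (for Boolean functions of four variables:
`3840` functions have Walsh support of size `8`) are this file's count, not a printed statement of the sources.
THEOREMS ONLY: no definition, no named fact, no instance, no `sorry`.  The split `60544 = 26880 + 33664` of the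
primitive types into ranks `11` and `17` is left to a sequel.

## References

* [Kubota1965] T. Kubota, *On the field extension by complex multiplication*, Trans. AMS 118 (1965), §2 (induced
  types), §4 Lemma 2 (the rank formula).
* [Gordon1999HodgeAVSurvey] B. B. Gordon, *A survey of the Hodge conjecture for abelian varieties*, §9.4.1
  (Prop. [B.60]).
* [Kida2019CountingCMTypes] M. Kida, *Counting formulas for CM-types*, Moscow J. Combin. Number Theory 8 (2019),
  Lemma 2.3, Prop. 3.1.
* [Dodson1984] B. Dodson, *The structure of Galois groups of CM-fields*, Trans. AMS 283 (1984), §3.1.1 Theorem.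
* [Shimura1998] G. Shimura, *Abelian Varieties with Complex Multiplication and Modular Functions*, §8.2 Prop. 26,
  §8.4 Examples (1), (2)(A).
* [Carlet2020] C. Carlet, *Boolean Functions for Cryptography and Coding Theory*, CUP (2020), §6.2 Def. 62
  (linear structures, partially-bent functions).

## Provenance

Lane `lit-hodgefound` (Track 2, Layer A3/A4), seat `lit-hodgefound-p10` generation 41, row g41-#1 (successor menu
(i)/(ii) of generation 40); neighbours cited by name, nothing restated: `CMTypeHalfSystemDictionary`
(`card_filter_isCMTypeWith_forall_mul_mem_iff_of_sq_eq_one`, `card_filter_isCMTypeWith_of_sq_eq_one`,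
`…_of_card_eq_sixteen / thirtyTwo`), `MultiquadraticCMFieldRankTwoCensus` (`card_filter_typeRank_eq_two`,
`typeRank_eq_two_iff_exists_eq_filter`, `two_mul_card_filter_apply_eq`), `DegenerateCMTypesElementaryAbelianRankFiveCensus`
(`card_filter_typeRank_eq_five_of_card_eq_sixteen / thirtyTwo`), `MultiquadraticCMFieldRankFiveCensus`
(`ncard_cmTypeRank_eq_five_of_finrank_eq_thirtyTwo`), `DegenerateCMTypesElementaryAbelianRankFive`
(`eight_mul_card_stabilizer_of_typeRank_eq_five`), `DegenerateCMTypesAbelianStabilizerIndexBound`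
(`two_mul_card_stabilizer_mul_typeRank_sub_one_le`, `one_mem_stabilizer`, `rho_not_forall_mul_mem_iff`),
`DegenerateCMTypesElementaryAbelianOrderThirtyTwo(Stabilizers)` (`typeRank_mem_of_card_thirtytwo`,
`exists_ne_one_forall_mul_mem_iff_of_typeRank_eq_nine`, `eq_one_of_forall_mul_mem_iff_of_nine_lt_typeRank`),
`DegenerateCMTypesElementaryAbelianTwoGroup` (`typeRank_mem_of_card_sixteen`), `DegenerateCMTypesCyclicCMFieldPrimeSquare`
(`CyclicPrimeSquare.ncard_cmType_sep_eq`), `DegenerateCMTypesCyclicCMFieldTwoOddPrimes` (`cmTypeRank_eq_typeRank_galType`).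
-/

open scoped BigOperators NumberField IsMulCommutative Classical
open NumberField Module

namespace Literature.AlgebraicGeometry.Pohlmann1968

namespace MultiquadraticRankNineCensus

open Literature.NumberTheory.ComplexMultiplication (typeRank IsCMTypeWith conjGal)
open Literature.NumberTheory.ComplexMultiplication.CyclicCMType.ExponentTwo (typeRank_mem_of_card_sixteen
  typeRank_mem_of_card_thirtytwo card_filter_typeRank_eq_five_of_card_eq_sixteen
  card_filter_typeRank_eq_five_of_card_eq_thirtyTwo eight_mul_card_stabilizer_of_typeRank_eq_five
  exists_ne_one_forall_mul_mem_iff_of_typeRank_eq_nine eq_one_of_forall_mul_mem_iff_of_nine_lt_typeRank)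
open Literature.NumberTheory.ComplexMultiplication.CyclicCMType.AbelianStabilizer
  (two_mul_card_stabilizer_mul_typeRank_sub_one_le one_mem_stabilizer rho_not_forall_mul_mem_iff)
open Literature.NumberTheory.ComplexMultiplication.CMTypeCounting (card_filter_isCMTypeWith_of_card_eq_sixteen
  card_filter_isCMTypeWith_of_card_eq_thirtyTwo card_filter_isCMTypeWith_forall_mul_mem_iff_of_sq_eq_one
  card_filter_isCMTypeWith_of_sq_eq_one)
open Literature.AlgebraicGeometry.Pohlmann1968.MultiquadraticRankTwoCensus (card_filter_typeRank_eq_two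
  typeRank_eq_two_iff_exists_eq_filter two_mul_card_filter_apply_eq)
open Literature.AlgebraicGeometry.Pohlmann1968.CyclicTwoOddPrimes (isCMTypeWith_galType
  cmTypeRank_eq_typeRank_galType)
open Literature.AlgebraicGeometry.Motives (CMType)

section Group

variable {G : Type*} [CommGroup G] [Fintype G] [DecidableEq G] {ρ : G} {T : Finset G}

/-! ## §0 Helpers -/

section Helpers

omit [Fintype G] [DecidableEq G] in
/-- `χ(gh) = χ(g)χ(h)`. [folklore] -/
private theorem char_mul_rn (χ : AddChar (Additive G) ℂ) (g h : G) :
    χ (Additive.ofMul (g * h)) = χ (Additive.ofMul g) * χ (Additive.ofMul h) := by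
  rw [ofMul_mul, AddChar.map_add_eq_mul]

/-- `#{g ≠ 1 : Tg = T} = |Stab(T)| − 1` (`1 ∈ Stab(T)`). [folklore] -/
private theorem card_filter_ne_one_stabilizer_eq (T : Finset G) :
    (Finset.univ.filter fun g : G => g ≠ 1 ∧ ∀ t : G, t * g ∈ T ↔ t ∈ T).card =
      (Finset.univ.filter fun g : G => ∀ t : G, t * g ∈ T ↔ t ∈ T).card - 1 := by
  have h : (Finset.univ.filter fun g : G => g ≠ 1 ∧ ∀ t : G, t * g ∈ T ↔ t ∈ T) =
      (Finset.univ.filter fun g : G => ∀ t : G, t * g ∈ T ↔ t ∈ T).erase 1 := by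
    ext g
    simp only [Finset.mem_filter, Finset.mem_univ, true_and, Finset.mem_erase]
  rw [h, Finset.card_erase_of_mem (one_mem_stabilizer T)]

omit [DecidableEq G] in
/-- `Σ_{T ∈ 𝒯} [rank T = r]·c = c · #{T ∈ 𝒯 : rank T = r}` for the finset `𝒯` of CM types. [folklore] -/
private theorem sum_ite_typeRank_eq (ρ : G) (r c : ℕ) :
    ∑ T ∈ (Finset.univ : Finset (Finset G)).filter (fun T : Finset G => IsCMTypeWith ρ (T : Set G)),
        (if typeRank G (T : Set G) = r then c else 0) =
      c * ((Finset.univ : Finset (Finset G)).filter fun T : Finset G =>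
        IsCMTypeWith ρ (T : Set G) ∧ typeRank G (T : Set G) = r).card := by
  rw [← Finset.sum_filter, Finset.filter_filter, Finset.sum_const, smul_eq_mul, mul_comm]

end Helpers

/-! ## §1 The stabiliser incidence `Σ_T (|Stab T| − 1) = (|G| − 2)·2^{|G|/4}` -/

section Incidence

/-- **The number of CM types stabilised by a given `g`**: `2^{|G|/4}` for `g ∉ {1, ρ}` (the types induced from the
quotient `G/⟨g⟩`, tree `card_filter_isCMTypeWith_forall_mul_mem_iff_of_sq_eq_one`), none for `g = ρ`; written with
the clause `g ≠ 1` so that `g = 1` also contributes `0`. [cite: Kida2019CountingCMTypes, Lemma 2.3]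
[cite: Kubota1965, §2] -/
theorem card_filter_ne_one_forall_mul_mem_iff (hexp : ∀ g : G, g ^ 2 = 1) (hρ1 : ρ ≠ 1) (g : G) :
    ((Finset.univ : Finset (Finset G)).filter fun T : Finset G =>
      IsCMTypeWith ρ (T : Set G) ∧ (g ≠ 1 ∧ ∀ t : G, t * g ∈ T ↔ t ∈ T)).card =
      if g = 1 ∨ g = ρ then 0 else 2 ^ (Fintype.card G / 4) := by
  by_cases h1 : g = 1
  · subst h1
    rw [if_pos (Or.inl rfl), Finset.card_eq_zero, Finset.filter_eq_empty_iff]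
    rintro T - ⟨-, h, -⟩
    exact h rfl
  by_cases hρ : g = ρ
  · subst hρ
    rw [if_pos (Or.inr rfl), Finset.card_eq_zero, Finset.filter_eq_empty_iff]
    rintro T - ⟨hT, -, hstab⟩
    exact rho_not_forall_mul_mem_iff hT hstab
  rw [if_neg (not_or.2 ⟨h1, hρ⟩)]
  have hfilter : ((Finset.univ : Finset (Finset G)).filter fun T : Finset G =>
      IsCMTypeWith ρ (T : Set G) ∧ (g ≠ 1 ∧ ∀ t : G, t * g ∈ T ↔ t ∈ T)) =
      (Finset.univ : Finset (Finset G)).filter fun T : Finset G =>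
        IsCMTypeWith ρ (T : Set G) ∧ ∀ t : G, t * g ∈ T ↔ t ∈ T :=
    Finset.filter_congr fun T _ => by simp only [ne_eq, h1, not_false_eq_true, true_and]
  rw [hfilter]
  convert card_filter_isCMTypeWith_forall_mul_mem_iff_of_sq_eq_one hexp hρ1 h1 hρ using 3

/-- `#{g : g ≠ 1, g ≠ ρ} = |G| − 2`. [folklore] -/
private theorem card_filter_not_eq_one_or_eq (hρ1 : ρ ≠ 1) :
    (Finset.univ.filter fun g : G => ¬ (g = 1 ∨ g = ρ)).card = Fintype.card G - 2 := by
  have hpair : (Finset.univ.filter fun g : G => g = 1 ∨ g = ρ) = ({1, ρ} : Finset G) := by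
    ext g
    simp only [Finset.mem_filter, Finset.mem_univ, true_and, Finset.mem_insert, Finset.mem_singleton]
  rw [Finset.filter_not, Finset.card_univ_sdiff, hpair, Finset.card_pair hρ1.symm]

/-- **THE STABILISER INCIDENCE.**  On a finite commutative group of exponent `2`, w.r.t. any `ρ ≠ 1`:
`Σ_{T CM type} #{g ≠ 1 : Tg = T} = (|G| − 2)·2^{|G|/4}` — double counting of the pairs `(T, g)` with `g ≠ 1`
stabilising `T`: each of the `|G| − 2` elements `g ∉ {1, ρ}` stabilises exactly the `2^{|G|/4}` types induced from
`G/⟨g⟩`, and `ρ` stabilises none. [cite: Kida2019CountingCMTypes, Lemma 2.3] [cite: Kubota1965, §2] -/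
theorem sum_card_filter_ne_one_stabilizer_eq (hexp : ∀ g : G, g ^ 2 = 1) (hρ1 : ρ ≠ 1) :
    ∑ T ∈ (Finset.univ : Finset (Finset G)).filter (fun T : Finset G => IsCMTypeWith ρ (T : Set G)),
        (Finset.univ.filter fun g : G => g ≠ 1 ∧ ∀ t : G, t * g ∈ T ↔ t ∈ T).card =
      (Fintype.card G - 2) * 2 ^ (Fintype.card G / 4) := by
  have step : ∀ T : Finset G, (Finset.univ.filter fun g : G => g ≠ 1 ∧ ∀ t : G, t * g ∈ T ↔ t ∈ T).card =
      ∑ g : G, if (g ≠ 1 ∧ ∀ t : G, t * g ∈ T ↔ t ∈ T) then 1 else 0 := fun T => Finset.card_filter _ _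
  rw [Finset.sum_congr rfl fun T _ => step T, Finset.sum_comm]
  have inner : ∀ g : G,
      (∑ T ∈ (Finset.univ : Finset (Finset G)).filter (fun T : Finset G => IsCMTypeWith ρ (T : Set G)),
        if (g ≠ 1 ∧ ∀ t : G, t * g ∈ T ↔ t ∈ T) then 1 else 0) =
        if g = 1 ∨ g = ρ then 0 else 2 ^ (Fintype.card G / 4) := by
    intro g
    rw [← Finset.card_filter, Finset.filter_filter]
    exact card_filter_ne_one_forall_mul_mem_iff hexp hρ1 g
  rw [Finset.sum_congr rfl fun g _ => inner g, Finset.sum_ite, Finset.sum_const_zero, zero_add,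
    Finset.sum_const, smul_eq_mul]
  congr 1
  convert card_filter_not_eq_one_or_eq hρ1 using 2

/-- **`Σ_{T CM type} |Stab(T)| = (|G| − 2)·2^{|G|/4} + 2^{|G|/2}`** (the incidence plus `1 ∈ Stab(T)` for each of
the `2^{|G|/2}` CM types). [cite: Kida2019CountingCMTypes, Lemma 2.3] [cite: Kubota1965, §2] -/
theorem sum_card_stabilizer_eq (hexp : ∀ g : G, g ^ 2 = 1) (hρ1 : ρ ≠ 1) :
    ∑ T ∈ (Finset.univ : Finset (Finset G)).filter (fun T : Finset G => IsCMTypeWith ρ (T : Set G)),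
        (Finset.univ.filter fun g : G => ∀ t : G, t * g ∈ T ↔ t ∈ T).card =
      (Fintype.card G - 2) * 2 ^ (Fintype.card G / 4) + 2 ^ (Fintype.card G / 2) := by
  have step : ∀ T : Finset G, (Finset.univ.filter fun g : G => ∀ t : G, t * g ∈ T ↔ t ∈ T).card =
      (Finset.univ.filter fun g : G => g ≠ 1 ∧ ∀ t : G, t * g ∈ T ↔ t ∈ T).card + 1 := by
    intro T
    rw [card_filter_ne_one_stabilizer_eq T]
    have := Finset.card_pos.2 ⟨1, one_mem_stabilizer T⟩
    omega
  rw [Finset.sum_congr rfl fun T _ => step T, Finset.sum_add_distrib, sum_card_filter_ne_one_stabilizer_eq hexp hρ1,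
    Finset.sum_const, smul_eq_mul, mul_one]
  congr 1
  convert card_filter_isCMTypeWith_of_sq_eq_one hexp hρ1 using 2

end Incidence

/-! ## §2 Stabiliser orders by rank -/

section Stabilizers

/-- **RANK `2` ⟹ `|Stab(T)| = |G|/2`** (every order): a rank-`2` type is a sign set `{χ = s}` of an odd character
(tree `typeRank_eq_two_iff_exists_eq_filter`), whose stabiliser is `ker χ`. [cite: Kubota1965, §4 Lemma 2]
[cite: Shimura1998, §8.4 Example (2)(A)] -/
theorem two_mul_card_stabilizer_of_typeRank_eq_two (hexp : ∀ g : G, g ^ 2 = 1) (h : IsCMTypeWith ρ (T : Set G))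
    (hr : typeRank G (T : Set G) = 2) :
    2 * (Finset.univ.filter fun g : G => ∀ t : G, t * g ∈ T ↔ t ∈ T).card = Fintype.card G := by
  obtain ⟨χ, hχ, s, hs, hT⟩ := (typeRank_eq_two_iff_exists_eq_filter hexp h).1 hr
  have hstab : (Finset.univ.filter fun g : G => ∀ t : G, t * g ∈ T ↔ t ∈ T) =
      Finset.univ.filter fun g : G => χ (Additive.ofMul g) = 1 := by
    ext g
    simp only [Finset.mem_filter, Finset.mem_univ, true_and]
    constructor
    · intro hg
      -- an element `t₀` with `χ(t₀) = s`: `1` if `s = 1`, `ρ` if `s = −1`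
      obtain ⟨t₀, ht₀⟩ : ∃ t₀ : G, χ (Additive.ofMul t₀) = s := by
        rcases hs with rfl | rfl
        · exact ⟨1, by rw [ofMul_one, AddChar.map_zero_eq_one]⟩
        · exact ⟨ρ, hχ⟩
      have ht₀T : t₀ ∈ T := by
        rw [hT, Finset.mem_filter]
        exact ⟨Finset.mem_univ _, ht₀⟩
      have h2 := (hg t₀).2 ht₀T
      rw [hT, Finset.mem_filter, char_mul_rn, ht₀] at h2
      have h3 : s * χ (Additive.ofMul g) = s * 1 := by rw [mul_one]; exact h2.2
      have hs0 : s ≠ 0 := by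
        rcases hs with rfl | rfl
        · exact one_ne_zero
        · exact neg_ne_zero.2 one_ne_zero
      exact mul_left_cancel₀ hs0 h3
    · intro hg t
      simp only [hT, Finset.mem_filter, Finset.mem_univ, true_and, char_mul_rn, hg, mul_one]
  rw [hstab]
  exact two_mul_card_filter_apply_eq hexp hχ (Or.inl rfl)

/-- **ORDER `32`, RANK `9` ⟹ `|Stab(T)| = 2`**: some `g ≠ 1` stabilises (tree
`exists_ne_one_forall_mul_mem_iff_of_typeRank_eq_nine`), and `2·|Stab|·(rank − 1) ≤ |G|` (tree
`two_mul_card_stabilizer_mul_typeRank_sub_one_le`) gives `|Stab| ≤ 2`. [cite: Kubota1965, §4 Lemma 2]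
[cite: Shimura1998, §32.10] -/
theorem card_stabilizer_eq_two_of_typeRank_eq_nine (hexp : ∀ g : G, g ^ 2 = 1) (h : IsCMTypeWith ρ (T : Set G))
    (h32 : Fintype.card G = 32) (hr : typeRank G (T : Set G) = 9) :
    (Finset.univ.filter fun g : G => ∀ t : G, t * g ∈ T ↔ t ∈ T).card = 2 := by
  have hle := two_mul_card_stabilizer_mul_typeRank_sub_one_le h
  rw [hr, h32] at hle
  obtain ⟨g, hg1, hg⟩ := exists_ne_one_forall_mul_mem_iff_of_typeRank_eq_nine hexp h h32 hr
  have h2 : 2 ≤ (Finset.univ.filter fun g : G => ∀ t : G, t * g ∈ T ↔ t ∈ T).card := by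
    have hsub : ({1, g} : Finset G) ⊆ Finset.univ.filter fun g : G => ∀ t : G, t * g ∈ T ↔ t ∈ T := by
      intro x hx
      rw [Finset.mem_insert, Finset.mem_singleton] at hx
      rcases hx with rfl | rfl
      · exact one_mem_stabilizer T
      · simp only [Finset.mem_filter, Finset.mem_univ, true_and]
        exact hg
    have := Finset.card_le_card hsub
    rwa [Finset.card_pair hg1.symm] at this
  omega

/-- **ORDER `32`, RANK `> 9` (i.e. `11` or `17`) ⟹ `Stab(T) = 1`** (tree `eq_one_of_forall_mul_mem_iff_of_nine_lt_typeRank`: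
a non-trivial stabiliser forces rank `≤ |G|/4 + 1 = 9`). [cite: Kubota1965, §2 and §4 Lemma 2] [cite: Shimura1998, §8.2 Prop. 26] -/
theorem card_stabilizer_eq_one_of_nine_lt_typeRank (hexp : ∀ g : G, g ^ 2 = 1) (h : IsCMTypeWith ρ (T : Set G))
    (h32 : Fintype.card G = 32) (hr : 9 < typeRank G (T : Set G)) :
    (Finset.univ.filter fun g : G => ∀ t : G, t * g ∈ T ↔ t ∈ T).card = 1 := by
  rw [Finset.card_eq_one]
  refine ⟨1, ?_⟩
  ext g
  simp only [Finset.mem_filter, Finset.mem_univ, true_and, Finset.mem_singleton]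
  constructor
  · exact fun hg => eq_one_of_forall_mul_mem_iff_of_nine_lt_typeRank hexp h h32 hr hg
  · rintro rfl t
    rw [mul_one]

/-- **THE STABILISER ORDERS IN ORDER `32`: `|Stab(T)| = 16, 4, 2, 1, 1` for `rank(T) = 2, 5, 9, 11, 17`** (rank `5`:
tree `eight_mul_card_stabilizer_of_typeRank_eq_five`). [cite: Kubota1965, §2 and §4 Lemma 2] [cite: Dodson1984, §3.1.1 Theorem] -/
theorem card_stabilizer_eq_of_card_eq_thirtyTwo (hexp : ∀ g : G, g ^ 2 = 1) (h : IsCMTypeWith ρ (T : Set G))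
    (h32 : Fintype.card G = 32) :
    (Finset.univ.filter fun g : G => ∀ t : G, t * g ∈ T ↔ t ∈ T).card =
      (if typeRank G (T : Set G) = 2 then 16 else 0) + (if typeRank G (T : Set G) = 5 then 4 else 0) +
        (if typeRank G (T : Set G) = 9 then 2 else 0) + (if 9 < typeRank G (T : Set G) then 1 else 0) := by
  rcases typeRank_mem_of_card_thirtytwo hexp h h32 with hr | hr | hr | hr | hr
  · rw [card_stabilizer_eq_one_of_nine_lt_typeRank hexp h h32 (by rw [hr]; norm_num), hr]
    norm_num
  · rw [card_stabilizer_eq_one_of_nine_lt_typeRank hexp h h32 (by rw [hr]; norm_num), hr]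
    norm_num
  · rw [card_stabilizer_eq_two_of_typeRank_eq_nine hexp h h32 hr, hr]
    norm_num
  · have h8 := eight_mul_card_stabilizer_of_typeRank_eq_five hexp h hr
    rw [h32] at h8
    have h4 : (Finset.univ.filter fun g : G => ∀ t : G, t * g ∈ T ↔ t ∈ T).card = 4 := by omega
    rw [h4, hr]
    norm_num
  · have h2 := two_mul_card_stabilizer_of_typeRank_eq_two hexp h hr
    rw [h32] at h2
    have h16 : (Finset.univ.filter fun g : G => ∀ t : G, t * g ∈ T ↔ t ∈ T).card = 16 := by omega
    rw [h16, hr]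
    norm_num

/-- The same table for `|Stab(T)| − 1 = #{g ≠ 1 : Tg = T}`: `15, 3, 1, 0, 0`. [cite: Kubota1965, §2 and §4 Lemma 2]
[cite: Dodson1984, §3.1.1 Theorem] -/
theorem card_filter_ne_one_stabilizer_eq_of_card_eq_thirtyTwo (hexp : ∀ g : G, g ^ 2 = 1)
    (h : IsCMTypeWith ρ (T : Set G)) (h32 : Fintype.card G = 32) :
    (Finset.univ.filter fun g : G => g ≠ 1 ∧ ∀ t : G, t * g ∈ T ↔ t ∈ T).card =
      (if typeRank G (T : Set G) = 2 then 15 else 0) + (if typeRank G (T : Set G) = 5 then 3 else 0) +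
        (if typeRank G (T : Set G) = 9 then 1 else 0) := by
  rw [card_filter_ne_one_stabilizer_eq T, card_stabilizer_eq_of_card_eq_thirtyTwo hexp h h32]
  rcases typeRank_mem_of_card_thirtytwo hexp h h32 with hr | hr | hr | hr | hr <;> rw [hr] <;> norm_num

end Stabilizers

/-! ## §3 Order `16`: the census `256 = 16 + 112 + 128` at group level -/

section Sixteen

/-- **ORDER `16` (`G ≅ (ℤ/2)⁴`): EXACTLY `128` OF THE `256` CM TYPES HAVE RANK `9`** (are nondegenerate) — the
spectrum is `{2, 5, 9}` (tree `typeRank_mem_of_card_sixteen`), with `16` types of rank `2` and `112` of rank `5`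
(tree).  The field-level form is the tree's `ncard_cmTypeRank_eq_of_finrank_eq_sixteen`. [cite: Kubota1965, §4 Lemma 2]
[cite: Kida2019CountingCMTypes, Lemma 2.3] [cite: Dodson1984, §3.1.1 Theorem] -/
theorem card_filter_typeRank_eq_nine_of_card_eq_sixteen (hexp : ∀ g : G, g ^ 2 = 1) (hρ1 : ρ ≠ 1)
    (h16 : Fintype.card G = 16) :
    ((Finset.univ : Finset (Finset G)).filter fun T : Finset G =>
      IsCMTypeWith ρ (T : Set G) ∧ typeRank G (T : Set G) = 9).card = 128 := by
  have htot : ((Finset.univ : Finset (Finset G)).filter fun T : Finset G => IsCMTypeWith ρ (T : Set G)).card =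
      256 := by
    convert card_filter_isCMTypeWith_of_card_eq_sixteen hexp hρ1 h16 using 2
  have h2 := card_filter_typeRank_eq_two hexp hρ1 (G := G)
  rw [h16] at h2
  have h5 := card_filter_typeRank_eq_five_of_card_eq_sixteen hexp hρ1 h16
  -- the types of rank `≠ 9` are those of rank `2` or `5`
  have hne : ((Finset.univ : Finset (Finset G)).filter fun T : Finset G =>
      IsCMTypeWith ρ (T : Set G) ∧ ¬ typeRank G (T : Set G) = 9).card = 16 + 112 := by
    rw [← h2, ← h5, ← Finset.card_union_of_disjoint (Finset.disjoint_filter.2 fun T _ hT hT' => by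
      have := hT.2; have := hT'.2; omega)]
    congr 1
    ext T
    simp only [Finset.mem_filter, Finset.mem_univ, true_and, Finset.mem_union]
    constructor
    · rintro ⟨hT, h9⟩
      rcases typeRank_mem_of_card_sixteen hexp hT h16 with h | h | h
      · exact absurd h h9
      · exact Or.inr ⟨hT, h⟩
      · exact Or.inl ⟨hT, h⟩
    · rintro (⟨hT, h⟩ | ⟨hT, h⟩) <;> exact ⟨hT, by rw [h]; norm_num⟩
  have hsplit := Finset.card_filter_add_card_filter_not
    (s := (Finset.univ : Finset (Finset G)).filter fun T : Finset G => IsCMTypeWith ρ (T : Set G))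
    (fun T : Finset G => typeRank G (T : Set G) = 9)
  rw [Finset.filter_filter, Finset.filter_filter, htot, hne] at hsplit
  omega

/-- **THE ORDER-`16` CENSUS**: `16` CM types of rank `2`, `112` of rank `5`, `128` of rank `9`, `256` in all.
[cite: Kubota1965, §4 Lemma 2] [cite: Kida2019CountingCMTypes, Lemma 2.3] [cite: Dodson1984, §3.1.1 Theorem] -/
theorem census_of_card_eq_sixteen (hexp : ∀ g : G, g ^ 2 = 1) (hρ1 : ρ ≠ 1) (h16 : Fintype.card G = 16) :
    ((Finset.univ : Finset (Finset G)).filter fun T : Finset G =>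
      IsCMTypeWith ρ (T : Set G) ∧ typeRank G (T : Set G) = 2).card = 16 ∧
    ((Finset.univ : Finset (Finset G)).filter fun T : Finset G =>
      IsCMTypeWith ρ (T : Set G) ∧ typeRank G (T : Set G) = 5).card = 112 ∧
    ((Finset.univ : Finset (Finset G)).filter fun T : Finset G =>
      IsCMTypeWith ρ (T : Set G) ∧ typeRank G (T : Set G) = 9).card = 128 ∧
    ((Finset.univ : Finset (Finset G)).filter fun T : Finset G => IsCMTypeWith ρ (T : Set G)).card = 256 := by
  have h2 := card_filter_typeRank_eq_two hexp hρ1 (G := G)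
  rw [h16] at h2
  refine ⟨h2, card_filter_typeRank_eq_five_of_card_eq_sixteen hexp hρ1 h16,
    card_filter_typeRank_eq_nine_of_card_eq_sixteen hexp hρ1 h16, ?_⟩
  convert card_filter_isCMTypeWith_of_card_eq_sixteen hexp hρ1 h16 using 2

end Sixteen

/-! ## §4 Order `32`: `3840` types of rank `9`, `4992` imprimitive, `60544` primitive -/

section ThirtyTwo

/-- **ORDER `32` (`G ≅ (ℤ/2)⁵`): EXACTLY `3840` OF THE `65536` CM TYPES HAVE KUBOTA RANK `9`.**  The stabiliser
incidence reads `15·#{rank 2} + 3·#{rank 5} + 1·#{rank 9} = (32 − 2)·2⁸`, i.e. `480 + 3360 + n₉ = 7680`.  (For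
Boolean functions of four variables: `3840` functions have a Walsh support of size `8`; on a multiquadratic CM field
of degree `32`: `3840` CM types are induced from the nondegenerate types of its subfields of degree `16`.)
[cite: Kubota1965, §2 and §4 Lemma 2] [cite: Kida2019CountingCMTypes, Lemma 2.3] [cite: Dodson1984, §3.1.1 Theorem]
[cite: Carlet2020, §6.2 Def. 62] -/
theorem card_filter_typeRank_eq_nine_of_card_eq_thirtyTwo (hexp : ∀ g : G, g ^ 2 = 1) (hρ1 : ρ ≠ 1)
    (h32 : Fintype.card G = 32) :
    ((Finset.univ : Finset (Finset G)).filter fun T : Finset G =>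
      IsCMTypeWith ρ (T : Set G) ∧ typeRank G (T : Set G) = 9).card = 3840 := by
  have hinc := sum_card_filter_ne_one_stabilizer_eq hexp hρ1 (G := G)
  rw [Finset.sum_congr rfl fun T hT =>
    card_filter_ne_one_stabilizer_eq_of_card_eq_thirtyTwo hexp (Finset.mem_filter.1 hT).2 h32,
    Finset.sum_add_distrib, Finset.sum_add_distrib, sum_ite_typeRank_eq ρ 2 15, sum_ite_typeRank_eq ρ 5 3,
    sum_ite_typeRank_eq ρ 9 1, card_filter_typeRank_eq_two hexp hρ1,
    card_filter_typeRank_eq_five_of_card_eq_thirtyTwo hexp hρ1 h32, h32] at hinc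
  norm_num at hinc
  omega

/-- **ORDER `32`: `4992 = 32 + 1120 + 3840` CM TYPES HAVE RANK `≤ 9`.** [cite: Kubota1965, §4 Lemma 2]
[cite: Kida2019CountingCMTypes, Lemma 2.3] [cite: Dodson1984, §3.1.1 Theorem] -/
theorem card_filter_typeRank_le_nine_of_card_eq_thirtyTwo (hexp : ∀ g : G, g ^ 2 = 1) (hρ1 : ρ ≠ 1)
    (h32 : Fintype.card G = 32) :
    ((Finset.univ : Finset (Finset G)).filter fun T : Finset G =>
      IsCMTypeWith ρ (T : Set G) ∧ typeRank G (T : Set G) ≤ 9).card = 4992 := by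
  have h2 := card_filter_typeRank_eq_two hexp hρ1 (G := G)
  rw [h32] at h2
  have h5 := card_filter_typeRank_eq_five_of_card_eq_thirtyTwo hexp hρ1 h32
  have h9 := card_filter_typeRank_eq_nine_of_card_eq_thirtyTwo hexp hρ1 h32
  have h25 : ((Finset.univ : Finset (Finset G)).filter fun T : Finset G =>
      IsCMTypeWith ρ (T : Set G) ∧ (typeRank G (T : Set G) = 2 ∨ typeRank G (T : Set G) = 5)).card = 32 + 1120 := by
    rw [← h2, ← h5, ← Finset.card_union_of_disjoint (Finset.disjoint_filter.2 fun T _ hT hT' => by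
      have := hT.2; have := hT'.2; omega), ← Finset.filter_or]
    congr 1
    exact Finset.filter_congr fun T _ => by tauto
  have hunion : ((Finset.univ : Finset (Finset G)).filter fun T : Finset G =>
      IsCMTypeWith ρ (T : Set G) ∧ typeRank G (T : Set G) ≤ 9) =
      ((Finset.univ : Finset (Finset G)).filter fun T : Finset G =>
        IsCMTypeWith ρ (T : Set G) ∧ (typeRank G (T : Set G) = 2 ∨ typeRank G (T : Set G) = 5)) ∪
      ((Finset.univ : Finset (Finset G)).filter fun T : Finset G =>
        IsCMTypeWith ρ (T : Set G) ∧ typeRank G (T : Set G) = 9) := by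
    ext T
    simp only [Finset.mem_filter, Finset.mem_univ, true_and, Finset.mem_union]
    constructor
    · rintro ⟨hT, hle⟩
      rcases typeRank_mem_of_card_thirtytwo hexp hT h32 with h | h | h | h | h
      · omega
      · omega
      · exact Or.inr ⟨hT, h⟩
      · exact Or.inl ⟨hT, Or.inr h⟩
      · exact Or.inl ⟨hT, Or.inl h⟩
    · rintro (⟨hT, h | h⟩ | ⟨hT, h⟩) <;> exact ⟨hT, by omega⟩
  rw [hunion, Finset.card_union_of_disjoint (Finset.disjoint_filter.2 fun T _ hT hT' => by
    have := hT.2; have := hT'.2; omega), h25, h9]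

/-- **ORDER `32`: `4992` CM TYPES ARE IMPRIMITIVE** — stabilised by some `g ≠ 1`, i.e. induced from a proper quotient
(⟺ rank `≤ 9`, tree `exists_ne_one_forall_mul_mem_iff_iff_typeRank_le_nine`). [cite: Kubota1965, §2 and §4 Lemma 2]
[cite: Shimura1998, §8.2 Prop. 26] [cite: Kida2019CountingCMTypes, Prop. 3.1] -/
theorem card_filter_exists_stabilizer_of_card_eq_thirtyTwo (hexp : ∀ g : G, g ^ 2 = 1) (hρ1 : ρ ≠ 1)
    (h32 : Fintype.card G = 32) :
    ((Finset.univ : Finset (Finset G)).filter fun T : Finset G =>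
      IsCMTypeWith ρ (T : Set G) ∧ ∃ g : G, g ≠ 1 ∧ ∀ t : G, t * g ∈ T ↔ t ∈ T).card = 4992 := by
  rw [← card_filter_typeRank_le_nine_of_card_eq_thirtyTwo hexp hρ1 h32]
  congr 1
  exact Finset.filter_congr fun T _ => and_congr_right fun hT =>
    Literature.NumberTheory.ComplexMultiplication.CyclicCMType.ExponentTwo.exists_ne_one_forall_mul_mem_iff_iff_typeRank_le_nine
      hexp hT h32

/-- **ORDER `32`: `60544 = 65536 − 4992` CM TYPES HAVE RANK `> 9`** (rank `11` or `17`). [cite: Kubota1965, §4 Lemma 2]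
[cite: Kida2019CountingCMTypes, Lemma 2.3 and Prop. 3.1] [cite: Dodson1984, §3.1.1 Theorem] -/
theorem card_filter_nine_lt_typeRank_of_card_eq_thirtyTwo (hexp : ∀ g : G, g ^ 2 = 1) (hρ1 : ρ ≠ 1)
    (h32 : Fintype.card G = 32) :
    ((Finset.univ : Finset (Finset G)).filter fun T : Finset G =>
      IsCMTypeWith ρ (T : Set G) ∧ 9 < typeRank G (T : Set G)).card = 60544 := by
  have htot : ((Finset.univ : Finset (Finset G)).filter fun T : Finset G => IsCMTypeWith ρ (T : Set G)).card =
      65536 := by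
    convert card_filter_isCMTypeWith_of_card_eq_thirtyTwo hexp hρ1 h32 using 2
  have hle := card_filter_typeRank_le_nine_of_card_eq_thirtyTwo hexp hρ1 h32
  have hsplit := Finset.card_filter_add_card_filter_not
    (s := (Finset.univ : Finset (Finset G)).filter fun T : Finset G => IsCMTypeWith ρ (T : Set G))
    (fun T : Finset G => typeRank G (T : Set G) ≤ 9)
  rw [Finset.filter_filter, Finset.filter_filter, htot, hle] at hsplit
  have hnot : ((Finset.univ : Finset (Finset G)).filter fun T : Finset G =>
      IsCMTypeWith ρ (T : Set G) ∧ ¬ typeRank G (T : Set G) ≤ 9) =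
      (Finset.univ : Finset (Finset G)).filter fun T : Finset G =>
        IsCMTypeWith ρ (T : Set G) ∧ 9 < typeRank G (T : Set G) :=
    Finset.filter_congr fun T _ => by rw [not_le]
  rw [hnot] at hsplit
  omega

/-- **ORDER `32`: `60544` CM TYPES HAVE RANK `11` OR `17`** (the same set). [cite: Kubota1965, §4 Lemma 2]
[cite: Kida2019CountingCMTypes, Lemma 2.3 and Prop. 3.1] [cite: Dodson1984, §3.1.1 Theorem] -/
theorem card_filter_typeRank_eq_eleven_or_seventeen_of_card_eq_thirtyTwo (hexp : ∀ g : G, g ^ 2 = 1)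
    (hρ1 : ρ ≠ 1) (h32 : Fintype.card G = 32) :
    ((Finset.univ : Finset (Finset G)).filter fun T : Finset G =>
      IsCMTypeWith ρ (T : Set G) ∧ (typeRank G (T : Set G) = 11 ∨ typeRank G (T : Set G) = 17)).card = 60544 := by
  rw [← card_filter_nine_lt_typeRank_of_card_eq_thirtyTwo hexp hρ1 h32]
  congr 1
  refine Finset.filter_congr fun T _ => and_congr_right fun hT => ?_
  constructor
  · rintro (h | h) <;> omega
  · intro hlt
    rcases typeRank_mem_of_card_thirtytwo hexp hT h32 with h | h | h | h | h
    · exact Or.inr h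
    · exact Or.inl h
    all_goals omega

/-- **ORDER `32`: `60544` CM TYPES ARE PRIMITIVE** — stabilised by no `g ≠ 1` (Hazama/Shimura: not induced from any
proper quotient; on the CM field: the type of a SIMPLE abelian `16`-fold).  (Kida's Prop. 3.1 gives the same number as
`Σ_{N ∌ ρ} μ(1, N)·2^{[G:N]/2} = 65536 − 30·256 + 140·16 − 120·4 + 16·2`; not used here.)
[cite: Shimura1998, §8.2 Prop. 26] [cite: Kida2019CountingCMTypes, Prop. 3.1] [cite: Kubota1965, §2 and §4 Lemma 2] -/
theorem card_filter_forall_stabilizer_eq_one_of_card_eq_thirtyTwo (hexp : ∀ g : G, g ^ 2 = 1) (hρ1 : ρ ≠ 1)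
    (h32 : Fintype.card G = 32) :
    ((Finset.univ : Finset (Finset G)).filter fun T : Finset G =>
      IsCMTypeWith ρ (T : Set G) ∧ ∀ g : G, (∀ t : G, t * g ∈ T ↔ t ∈ T) → g = 1).card = 60544 := by
  rw [← card_filter_nine_lt_typeRank_of_card_eq_thirtyTwo hexp hρ1 h32]
  congr 1
  refine Finset.filter_congr fun T _ => and_congr_right fun hT => ?_
  have key := Literature.NumberTheory.ComplexMultiplication.CyclicCMType.ExponentTwo.exists_ne_one_forall_mul_mem_iff_iff_typeRank_le_nine
    hexp hT h32
  constructor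
  · intro hprim
    by_contra hle
    rw [not_lt] at hle
    obtain ⟨g, hg1, hg⟩ := key.2 hle
    exact hg1 (hprim g hg)
  · intro hlt g hg
    by_contra hg1
    have := key.1 ⟨g, hg1, hg⟩
    omega

/-- **THE IMPRIMITIVE PART OF THE ORDER-`32` CENSUS**: `32` types of rank `2`, `1120` of rank `5`, `3840` of rank
`9`, `60544` of rank `11` or `17`, `65536` in all. [cite: Kubota1965, §4 Lemma 2] [cite: Kida2019CountingCMTypes, Lemma 2.3]
[cite: Dodson1984, §3.1.1 Theorem] -/
theorem census_imprimitive_of_card_eq_thirtyTwo (hexp : ∀ g : G, g ^ 2 = 1) (hρ1 : ρ ≠ 1)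
    (h32 : Fintype.card G = 32) :
    ((Finset.univ : Finset (Finset G)).filter fun T : Finset G =>
      IsCMTypeWith ρ (T : Set G) ∧ typeRank G (T : Set G) = 2).card = 32 ∧
    ((Finset.univ : Finset (Finset G)).filter fun T : Finset G =>
      IsCMTypeWith ρ (T : Set G) ∧ typeRank G (T : Set G) = 5).card = 1120 ∧
    ((Finset.univ : Finset (Finset G)).filter fun T : Finset G =>
      IsCMTypeWith ρ (T : Set G) ∧ typeRank G (T : Set G) = 9).card = 3840 ∧
    ((Finset.univ : Finset (Finset G)).filter fun T : Finset G =>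
      IsCMTypeWith ρ (T : Set G) ∧ (typeRank G (T : Set G) = 11 ∨ typeRank G (T : Set G) = 17)).card = 60544 ∧
    ((Finset.univ : Finset (Finset G)).filter fun T : Finset G => IsCMTypeWith ρ (T : Set G)).card = 65536 := by
  have h2 := card_filter_typeRank_eq_two hexp hρ1 (G := G)
  rw [h32] at h2
  refine ⟨h2, card_filter_typeRank_eq_five_of_card_eq_thirtyTwo hexp hρ1 h32,
    card_filter_typeRank_eq_nine_of_card_eq_thirtyTwo hexp hρ1 h32,
    card_filter_typeRank_eq_eleven_or_seventeen_of_card_eq_thirtyTwo hexp hρ1 h32, ?_⟩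
  convert card_filter_isCMTypeWith_of_card_eq_thirtyTwo hexp hρ1 h32 using 2

end ThirtyTwo

end Group

/-! ## §5 Multiquadratic CM fields of degree `32` -/

section Field

variable {K : Type} [Field K] [NumberField K] [IsCMField K] [IsGalois ℚ K]

/-- Transport of a count from the Galois group (tree `CyclicPrimeSquare.ncard_cmType_sep_eq`), for any predicate on
the rank. [cite: Shimura1998, §8.1 and §18.2 Lemma (i)] -/
private theorem ncard_cmTypeRank_eq_card_filter (hexp : ∀ g : K ≃ₐ[ℚ] K, g ^ 2 = 1) (φ₀ : K →+* ℂ)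
    (P : ℕ → Prop) :
    {Φ : CMType K | P (cmTypeRank Φ)}.ncard =
      ((Finset.univ : Finset (Finset (K ≃ₐ[ℚ] K))).filter fun T : Finset (K ≃ₐ[ℚ] K) =>
        IsCMTypeWith (conjGal : K ≃ₐ[ℚ] K) (T : Set (K ≃ₐ[ℚ] K)) ∧
          P (typeRank (K ≃ₐ[ℚ] K) (T : Set (K ≃ₐ[ℚ] K)))).card := by
  haveI := Multiquadratic.isAbelianGalois_of_forall_sq_eq_one hexp
  have hρ := AbelianCMFieldExistence.apply_conjGal_eq (K := K) φ₀
  rw [CyclicPrimeSquare.ncard_cmType_sep_eq hρ (fun Φ : CMType K => P (cmTypeRank Φ))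
    (fun T : Finset (K ≃ₐ[ℚ] K) => P (typeRank (K ≃ₐ[ℚ] K) (T : Set (K ≃ₐ[ℚ] K))))
    (fun Φ => by rw [cmTypeRank_eq_typeRank_galType Φ φ₀])]
  have hset : {ΦG : Finset (K ≃ₐ[ℚ] K) | IsCMTypeWith (conjGal : K ≃ₐ[ℚ] K) (ΦG : Set (K ≃ₐ[ℚ] K)) ∧
      P (typeRank (K ≃ₐ[ℚ] K) (ΦG : Set (K ≃ₐ[ℚ] K)))} =
      ↑((Finset.univ : Finset (Finset (K ≃ₐ[ℚ] K))).filter fun T : Finset (K ≃ₐ[ℚ] K) =>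
        IsCMTypeWith (conjGal : K ≃ₐ[ℚ] K) (T : Set (K ≃ₐ[ℚ] K)) ∧
          P (typeRank (K ≃ₐ[ℚ] K) (T : Set (K ≃ₐ[ℚ] K)))) := by
    ext T; simp
  rw [hset, Set.ncard_coe_finset]

/-- **A MULTIQUADRATIC CM FIELD OF DEGREE `32` HAS EXACTLY `3840` CM TYPES OF RANK `9`** (each induced from a
nondegenerate type of a subfield of degree `16`, tree `exists_inducedCMType_sixteen_of_cmTypeRank_eq_nine_of_finrank_eq_thirtytwo`).
[cite: Kubota1965, §2 and §4 Lemma 2] [cite: Kida2019CountingCMTypes, Lemma 2.3] [cite: Dodson1984, §3.1.1 Theorem] -/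
theorem ncard_cmTypeRank_eq_nine_of_finrank_eq_thirtyTwo (hexp : ∀ g : K ≃ₐ[ℚ] K, g ^ 2 = 1) (φ₀ : K →+* ℂ)
    (hK : finrank ℚ K = 32) : {Φ : CMType K | cmTypeRank Φ = 9}.ncard = 3840 := by
  haveI := Multiquadratic.isAbelianGalois_of_forall_sq_eq_one hexp
  have hρ := AbelianCMFieldExistence.apply_conjGal_eq (K := K) φ₀
  rw [ncard_cmTypeRank_eq_card_filter hexp φ₀ (fun r => r = 9)]
  convert card_filter_typeRank_eq_nine_of_card_eq_thirtyTwo hexp (conjGalElt_ne_one hρ)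
    (by rw [card_gal_eq_finrank φ₀, hK]) using 3

/-- **Degree `32`: `4992` CM types of rank `≤ 9`** (the non-primitive ones: `32 + 1120 + 3840`, induced from
subfields of degree `2`, `8`, `16`). [cite: Kubota1965, §2 and §4 Lemma 2] [cite: Shimura1998, §8.2 Prop. 26]
[cite: Kida2019CountingCMTypes, Lemma 2.3] -/
theorem ncard_cmTypeRank_le_nine_of_finrank_eq_thirtyTwo (hexp : ∀ g : K ≃ₐ[ℚ] K, g ^ 2 = 1) (φ₀ : K →+* ℂ)
    (hK : finrank ℚ K = 32) : {Φ : CMType K | cmTypeRank Φ ≤ 9}.ncard = 4992 := by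
  haveI := Multiquadratic.isAbelianGalois_of_forall_sq_eq_one hexp
  have hρ := AbelianCMFieldExistence.apply_conjGal_eq (K := K) φ₀
  rw [ncard_cmTypeRank_eq_card_filter hexp φ₀ (fun r => r ≤ 9)]
  convert card_filter_typeRank_le_nine_of_card_eq_thirtyTwo hexp (conjGalElt_ne_one hρ)
    (by rw [card_gal_eq_finrank φ₀, hK]) using 3

/-- **A MULTIQUADRATIC CM FIELD OF DEGREE `32` HAS EXACTLY `60544` CM TYPES OF RANK `> 9`** (rank `11` or `17`:
the primitive types — by the tree's `isSimple_iff_cmTypeRank_eq_eleven_or_seventeen`, the types of the SIMPLE abelian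
`16`-folds with complex multiplication by `K`). [cite: Shimura1998, §8.2 Prop. 26] [cite: Kubota1965, §2 and §4 Lemma 2]
[cite: Kida2019CountingCMTypes, Prop. 3.1] -/
theorem ncard_nine_lt_cmTypeRank_of_finrank_eq_thirtyTwo (hexp : ∀ g : K ≃ₐ[ℚ] K, g ^ 2 = 1) (φ₀ : K →+* ℂ)
    (hK : finrank ℚ K = 32) : {Φ : CMType K | 9 < cmTypeRank Φ}.ncard = 60544 := by
  haveI := Multiquadratic.isAbelianGalois_of_forall_sq_eq_one hexp
  have hρ := AbelianCMFieldExistence.apply_conjGal_eq (K := K) φ₀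
  rw [ncard_cmTypeRank_eq_card_filter hexp φ₀ (fun r => 9 < r)]
  convert card_filter_nine_lt_typeRank_of_card_eq_thirtyTwo hexp (conjGalElt_ne_one hρ)
    (by rw [card_gal_eq_finrank φ₀, hK]) using 3

/-- **Degree `32`: `60544` CM types of rank `11` or `17`.** [cite: Kubota1965, §4 Lemma 2]
[cite: Kida2019CountingCMTypes, Prop. 3.1] [cite: Dodson1984, §3.1.1 Theorem] -/
theorem ncard_cmTypeRank_eq_eleven_or_seventeen_of_finrank_eq_thirtyTwo (hexp : ∀ g : K ≃ₐ[ℚ] K, g ^ 2 = 1)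
    (φ₀ : K →+* ℂ) (hK : finrank ℚ K = 32) :
    {Φ : CMType K | cmTypeRank Φ = 11 ∨ cmTypeRank Φ = 17}.ncard = 60544 := by
  haveI := Multiquadratic.isAbelianGalois_of_forall_sq_eq_one hexp
  have hρ := AbelianCMFieldExistence.apply_conjGal_eq (K := K) φ₀
  rw [ncard_cmTypeRank_eq_card_filter hexp φ₀ (fun r => r = 11 ∨ r = 17)]
  convert card_filter_typeRank_eq_eleven_or_seventeen_of_card_eq_thirtyTwo hexp (conjGalElt_ne_one hρ)
    (by rw [card_gal_eq_finrank φ₀, hK]) using 3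

end Field

end MultiquadraticRankNineCensus

end Literature.AlgebraicGeometry.Pohlmann1968
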